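import Literature.NumberTheory.EllipticCurves.Kato2004.IwasawaH1Reduction
import Literature.NumberTheory.EllipticCurves.Kato2004.IwasawaCohomologyLevelZero
import HarnessLib

/-!
# Kato 2004 (Astérisque 295) §13.8 at level `p^k`: the reduction `T_pW → W[p^k]`, the levelwise
# reductions `H¹(U, T_pW) → H¹(U, W[p^k])`, their tower compatibility, and the reductions on the
# pinned datum `Kato2004.IwasawaH1Data` (including the level-`0` map out of the coinvariants)

Topic `NumberTheory/EllipticCurves`, sub-directory `Kato2004` (namespace = path).  Cell `bsd-cn100`,
typer seat `bsd-cn100-ty` (g7): target (b) of the cell plan (D0074-bsd-cn100-seats §6 add. 5), the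
mod-`p^k` TWIN of `Kato2004/IwasawaH1Reduction.lean` §2–§3 (cell `bsd-smallim`, which is the case
`k = 1`: `tateModP`, `reduceH1`, `IwasawaH1Data.red`).  PLUMBING for the definition item
`defn-HasLocPKummerLog` (the "red_{p^k}" clause of HOME/bsd-cn100-plan/DEFN-DECISIONS-g13.md §Q2: a
class `x ∈ H¹(ℚ, T_pW)` in the Kato currency `H1 (tateRep W p) (κ.layerSubgroup 0)` is compared with
local Kummer classes of `W[p^k]` AT EVERY LEVEL `k ≥ 1`, either after reduction + localisation (dialect
α) or as the compatible family `(red_{p^k} x)_k` (dialect β)).  Everything here is a DEFINITION WITH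
BODY or a PROVED lemma; no named fact is introduced (D-0026); nothing about BSD is claimed.

## Contents

* §1 `tateModPk W p k : T_pW →+ W[p^k]`, `a = (a_n)_n ↦ a_k` (`TateModule.proj p k`, values in
  `geomTorsion W ((p : ℤ) ^ k)`), continuous and `Γ_ℚ`-equivariant; the tower relation
  `(p : ℤ) • a_{k+1} = a_k` (`zsmul_coe_tateModPk_succ`); agreement with `tateModP` at `k = 1` on
  underlying points.
* §2 `reduceH1Pk W p k U : H¹(U, T_pW) → H¹(U, W[p^k])` for a subgroup `U ≤ Γ_ℚ` (`mapH1AddHom` along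
  `tateModPk`), with its cocycle formula and its compatibility with restriction `resLe`, relative
  corestriction `coresLe`, the trace maps `layerCores` of a `ℤ_p`-extension, the conjugation action
  `conjMap`, the integral classes `integralH1`, and `red_{p^k}(p^k • c) = 0`.
* §3 TOWER COMPATIBILITY: for ANY additive map `f : W[p^{k+1}] → W[p^k]` with `f P = p • P` on points
  (e.g. `WeierstrassCurve.geomTorsionReduce` of `HeegnerModuleIndex.lean`, or `torsionMulBy` of
  `KummerSelmerStructure.lean` up to the cast `p * p^k = p^(k+1)`; quantified to keep this file
  import-light), `f_* ∘ red_{p^{k+1}} = red_{p^k}` on `H¹(U, ·)` (`mapH1AddHom_reduceH1Pk_succ`) —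
  the "compatible family" clause of dialect β.
* §4 On the pin `I : IwasawaH1Data W p κ γ`: `I.redPk k : 𝐇¹_Γ(T_pW) → ∏_n H¹(ℚ_n, W[p^k])`
  (norm-compatible integral values, `T` acts as `conj_γ − 1`, `p^k • x ↦ 0`), and the LEVEL-`0` map
  out of the coinvariants `I.redZeroPk k : 𝐇¹_Γ/T𝐇¹_Γ → H¹(Γ_ℚ, W[p^k])`,
  `[x] ↦ red_{p^k}(proj₀ x)` (`reduceH1Pk ∘ projZero`) — the class "`red_{p^k}(ι(z̄))`" of the
  Kato–zeta road before localisation.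

References: K. Kato, Astérisque 295 (2004) §13.8 (pp. 228–229: "`H¹(T) →x H¹(T)`", change of
coefficients `T → T/xT`), §12.2 (p. 220), §14.14 (14.14.1) (p. 243) [Kato2004Asterisque];
B. Perrin-Riou, Bull. SMF 115 (1987) §0 (the transition maps "induits par la multiplication par `p`")
[PerrinRiou1987BSMF]; J.-P. Serre, *Galois Cohomology* I §2.2–2.4 [SerreGaloisCohomology1997]; tree:
`Kato2004/IwasawaH1Reduction.lean` (§1 `mapH1AddHom` and its `resLe`/`coresLe`/`conjMap` lemmas; §2–§3
the case `k = 1`, mirrored line by line), `Kato2004/IwasawaCohomologyLevelZero.lean` (`projZero`),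
`TateModule.lean` (`TateModule.proj`, `smul_proj_succ`, `proj_mem_torsionBy`).
-/

noncomputable section

open scoped NumberField
open Field IsDedekindDomain CategoryTheory
open Literature.NumberTheory.GaloisRepresentations
open Literature.NumberTheory.EllipticCurves Literature.NumberTheory.EllipticCurves.Kato2004
open Literature.NumberTheory.EllipticCurves.Kato2004.EulerSystemValues
open Literature.NumberTheory.EllipticCurves.IwasawaAlgebra
open WeierstrassCurve (geomPoints geomTorsion)

/-! ## §1 The reduction `T_pW → W[p^k]` -/

namespace Literature.NumberTheory.EllipticCurves.Kato2004

section Reduction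

variable (W : WeierstrassCurve ℚ) [W.IsElliptic] (p : ℕ) [Fact p.Prime] (k : ℕ)

/-- **Reduction modulo `p^k` on the Tate module**: `T_pW → W[p^k]`, `a = (a_n)_n ↦ a_k` (the `k`-th
component `TateModule.proj p k`, with values in `E(ℚ̄)[p^k] = geomTorsion W (p^k)`).  This is the map
`T → T/p^kT` (Kato §13.8 with `x = p^k`) for `T = T_pW`; `k = 1` is `tateModP`.
[cite: Kato2004Asterisque, §13.8 (p. 228)] -/
def tateModPk : W.tateModule p →+ geomTorsion W ((p : ℤ) ^ k) where
  toFun a := ⟨TateModule.proj p k a, by simpa using W.proj_tateModule_mem_geomTorsion p k a⟩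
  map_zero' := Subtype.ext (map_zero _)
  map_add' a b := Subtype.ext (map_add _ a b)

omit [W.IsElliptic] [Fact p.Prime] in
/-- Unfolding `tateModPk`: its value is the `k`-th component. [cite: Kato2004Asterisque, §13.8 (p. 228)] -/
@[simp]
theorem coe_tateModPk_apply (a : W.tateModule p) :
    ((tateModPk W p k a : geomTorsion W ((p : ℤ) ^ k)) : geomPoints W) = TateModule.proj p k a :=
  rfl

omit [W.IsElliptic] [Fact p.Prime] in
/-- `tateModPk` is continuous (the components of `T_pW` are continuous, `W[p^k]` is discrete).
[cite: Kato2004Asterisque, §13.8 (p. 228)] -/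
theorem continuous_tateModPk : Continuous (tateModPk W p k) :=
  Continuous.subtype_mk (TateModule.continuous_proj (A := geomPoints W) (p := p) k) _

omit [W.IsElliptic] [Fact p.Prime] in
/-- `tateModPk` is `Γ_ℚ`-equivariant (the action on `T_pW` is componentwise).
[cite: Kato2004Asterisque, §13.8 (p. 228)] -/
theorem tateModPk_smul (σ : absoluteGaloisGroup ℚ) (a : W.tateModule p) :
    tateModPk W p k (σ • a) = σ • tateModPk W p k a :=
  Subtype.ext (by
    rw [coe_tateModPk_apply, TateModule.proj_smul_of_distribMulAction,
      AddSubgroup.torsionBy.coe_smul, coe_tateModPk_apply])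

omit [W.IsElliptic] [Fact p.Prime] in
/-- **The tower relation on points**: `(p : ℤ) • a_{k+1} = a_k`, i.e. the reductions modulo `p^{k+1}`
and `p^k` are compatible under multiplication by `p` (`TateModule.smul_proj_succ`).
[cite: PerrinRiou1987BSMF, §0 (p. 401)] -/
theorem zsmul_coe_tateModPk_succ (a : W.tateModule p) :
    (p : ℤ) • ((tateModPk W p (k + 1) a : geomTorsion W ((p : ℤ) ^ (k + 1))) : geomPoints W) =
      ((tateModPk W p k a : geomTorsion W ((p : ℤ) ^ k)) : geomPoints W) := by
  rw [coe_tateModPk_apply, coe_tateModPk_apply, ← TateModule.smul_proj_succ k a, natCast_zsmul]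

omit [W.IsElliptic] [Fact p.Prime] in
/-- Agreement with the mod-`p` reduction of `IwasawaH1Reduction.lean` on underlying points:
`tateModPk W p 1 a = tateModP W p a` in `E(ℚ̄)` (the targets `W[(p:ℤ)^1]` and `W[p]` differ only by the
exponent `1`). [cite: Kato2004Asterisque, §13.8 (p. 228)] -/
theorem coe_tateModPk_one (a : W.tateModule p) :
    ((tateModPk W p 1 a : geomTorsion W ((p : ℤ) ^ 1)) : geomPoints W) =
      ((tateModP W p a : geomTorsion W (p : ℤ)) : geomPoints W) := by
  rw [coe_tateModPk_apply, coe_tateModP_apply]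

variable [ContinuousSMul ℤ_[p] (W.tateModule p)]

/-- Equivariance of `tateModPk` for the restricted representations `T_pW|_U`, `W[p^k]|_U` of a subgroup
`U ≤ Γ_ℚ` (the hypothesis shape of `mapH1AddHom`). [cite: Kato2004Asterisque, §13.8 (p. 228)] -/
theorem tateModPk_subgroupRep (U : Subgroup (absoluteGaloisGroup ℚ)) (u : U) (a : W.tateModule p) :
    tateModPk W p k ((subgroupRep (tateRep W p).toTopRep U).ρ u a) =
      (subgroupRep (W.torsionGaloisModule ((p : ℤ) ^ k)).toTopRep U).ρ u (tateModPk W p k a) :=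
  tateModPk_smul W p k (u : absoluteGaloisGroup ℚ) a

/-- Equivariance of `tateModPk` for the full representations (the hypothesis shape of
`mapH1AddHom_conjMap`). [cite: Kato2004Asterisque, §13.8 (p. 228)] -/
theorem tateModPk_toTopRep (σ : absoluteGaloisGroup ℚ) (a : W.tateModule p) :
    tateModPk W p k ((tateRep W p).toTopRep.ρ σ a) =
      (W.torsionGaloisModule ((p : ℤ) ^ k)).toTopRep.ρ σ (tateModPk W p k a) :=
  tateModPk_smul W p k σ a

/-! ## §2 The levelwise reduction `H¹(U, T_pW) → H¹(U, W[p^k])` -/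

/-- **The levelwise reduction `red_{U,p^k} : H¹(U, T_pW) → H¹(U, W[p^k])`** for a subgroup `U ≤ Γ_ℚ`
(`U = Gal(ℚ̄/F)`: `H¹(F, T_pW) → H¹(F, W[p^k])`), induced on continuous cochains by `T_pW → W[p^k]`
(`mapH1AddHom` along `tateModPk`; source over `ℤ_p`, target the discrete `ℤ`-module `W[p^k]` of
`W.torsionGaloisModule (p^k)`).  This is the change of coefficients `T → T/p^k` (Kato §13.8) at a finite
level; `k = 1` is `reduceH1`.  [cite: Kato2004Asterisque, §13.8 (pp. 228–229)] -/
def reduceH1Pk (U : Subgroup (absoluteGaloisGroup ℚ)) :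
    H1 (tateRep W p) U →+ H1 (W.torsionGaloisModule ((p : ℤ) ^ k)) U :=
  mapH1AddHom (subgroupRep (tateRep W p).toTopRep U)
    (subgroupRep (W.torsionGaloisModule ((p : ℤ) ^ k)).toTopRep U) (tateModPk W p k)
    (continuous_tateModPk W p k) (tateModPk_subgroupRep W p k U)

/-- `reduceH1Pk` on explicit cocycles: `red [φ] = [φ mod p^k]`. [cite: Kato2004Asterisque, §13.8 (p. 228)] -/
theorem reduceH1Pk_oneCocycleClass (U : Subgroup (absoluteGaloisGroup ℚ))
    (φ : contOneCocycles (subgroupRep (tateRep W p).toTopRep U)) :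
    reduceH1Pk W p k U (oneCocycleClass _ φ) =
      oneCocycleClass _ (contOneCocycles.pushAddHom (tateModPk W p k) (continuous_tateModPk W p k)
        (tateModPk_subgroupRep W p k U) φ) :=
  mapH1AddHom_oneCocycleClass _ _ _ φ

/-- `red_{p^k}` commutes with restriction `H¹(U', ·) → H¹(U, ·)`, `U ≤ U'` (e.g. the restriction to a
decomposition group, dialect α of `defn-HasLocPKummerLog`). [cite: Kato2004Asterisque, §13.8 (p. 228)] -/
theorem reduceH1Pk_resLe {U U' : Subgroup (absoluteGaloisGroup ℚ)} (h : U ≤ U')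
    (c : H1 (tateRep W p) U') :
    reduceH1Pk W p k U (resLe (tateRep W p).toTopRep h 1 c) =
      resLe (W.torsionGaloisModule ((p : ℤ) ^ k)).toTopRep h 1 (reduceH1Pk W p k U' c) :=
  mapH1AddHom_resLe _ _ h _ _ c

/-- `red_{p^k}` commutes with the relative corestriction `Cor : H¹(U, ·) → H¹(U', ·)`, `U ≤ U'` open of
finite index. [cite: Kato2004Asterisque, §13.8 (p. 228)] -/
theorem reduceH1Pk_coresLe {U U' : Subgroup (absoluteGaloisGroup ℚ)} (h : U ≤ U')
    (hU : IsOpen (U : Set (absoluteGaloisGroup ℚ))) [hF : Fintype (U' ⧸ U.subgroupOf U')]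
    (c : H1 (tateRep W p) U) :
    reduceH1Pk W p k U' (coresLe (tateRep W p).toTopRep h hU c) =
      coresLe (W.torsionGaloisModule ((p : ℤ) ^ k)).toTopRep h hU (reduceH1Pk W p k U c) :=
  mapH1AddHom_coresLe (hF := hF) _ _ h hU _ _ c

/-- `red_{p^k}` commutes with the trace maps `Cor : H¹(ℚ_{n+1}, ·) → H¹(ℚ_n, ·)` of a `ℤ_p`-extension
(`Kato2004.layerCores`). [cite: Kato2004Asterisque, §12.2 (p. 220) and §13.8 (p. 228)] -/
theorem reduceH1Pk_layerCores (κ : ZpExtension ℚ p) (n : ℕ)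
    (c : H1 (tateRep W p) (κ.layerSubgroup (n + 1))) :
    reduceH1Pk W p k (κ.layerSubgroup n) (layerCores (tateRep W p) κ n c) =
      layerCores (W.torsionGaloisModule ((p : ℤ) ^ k)) κ n
        (reduceH1Pk W p k (κ.layerSubgroup (n + 1)) c) := by
  unfold layerCores
  exact reduceH1Pk_coresLe W p k (hF := _) _ _ c

/-- `red_{p^k}` commutes with the action of `σ ∈ Γ_ℚ` on `H¹(U, ·)` for `U` normal (`conjMap`; e.g.
`conj_γ` on the layers of a `ℤ_p`-extension, through which `T ∈ Λ` acts as `conj_γ − 1`).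
[cite: Kato2004Asterisque, §13.8 (p. 228)] -/
theorem reduceH1Pk_conjMap (U : Subgroup (absoluteGaloisGroup ℚ)) [U.Normal]
    (σ : absoluteGaloisGroup ℚ) (c : H1 (tateRep W p) U) :
    reduceH1Pk W p k U (conjMap (tateRep W p).toTopRep U σ 1 c) =
      conjMap (W.torsionGaloisModule ((p : ℤ) ^ k)).toTopRep U σ 1 (reduceH1Pk W p k U c) :=
  mapH1AddHom_conjMap _ _ (tateModPk_toTopRep W p k) σ _ c

/-- **Integral classes reduce to integral classes**: `red_{p^k} (H¹(O_F[1/p], T_pW)) ⊆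
H¹(O_F[1/p], W[p^k])` (`integralH1` = classes vanishing on every inertia group away from `p`; `red`
commutes with the restrictions to `U ⊓ I_𝔓`). [cite: Kato2004Asterisque, §8.2 and Lemma 8.5 (pp. 180–184)] -/
theorem reduceH1Pk_mem_integralH1 (U : Subgroup (absoluteGaloisGroup ℚ)) {c : H1 (tateRep W p) U}
    (hc : c ∈ integralH1 (tateRep W p) p U) :
    reduceH1Pk W p k U c ∈ integralH1 (W.torsionGaloisModule ((p : ℤ) ^ k)) p U := by
  rw [mem_integralH1_iff] at hc ⊢
  intro v hv 𝔓 h𝔓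
  rw [← reduceH1Pk_resLe, hc v hv 𝔓 h𝔓, map_zero]

/-- `red_{p^k}` kills `p^k`-multiples: `red_{p^k} (p^k • c) = 0` (the coefficients `W[p^k]` are killed
by `p^k`). [cite: Kato2004Asterisque, §13.8 (p. 228)] -/
theorem reduceH1Pk_pow_smul (U : Subgroup (absoluteGaloisGroup ℚ)) (c : H1 (tateRep W p) U) :
    reduceH1Pk W p k U (((p : ℤ_[p]) ^ k) • c) = 0 := by
  obtain ⟨φ, rfl⟩ := oneCocycleClass_surjective _ c
  rw [← oneCocycleClass_smul, reduceH1Pk_oneCocycleClass, oneCocycleClass_eq_zero_iff]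
  refine ⟨0, fun g ↦ ?_⟩
  rw [map_zero, sub_zero, contOneCocycles.pushAddHom_apply]
  apply Subtype.ext
  rw [coe_tateModPk_apply]
  change TateModule.proj p k ((((p : ℤ_[p]) ^ k) • φ).1 g) = 0
  rw [Submodule.coe_smul, ContinuousMap.smul_apply, ← Nat.cast_pow, Nat.cast_smul_eq_nsmul, map_nsmul]
  exact TateModule.pow_smul_proj k (φ.1 g)

/-! ## §3 Tower compatibility: `(p •)_* ∘ red_{p^{k+1}} = red_{p^k}` -/

omit [W.IsElliptic] [Fact p.Prime] [ContinuousSMul ℤ_[p] (W.tateModule p)] in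
/-- A transition map `f : W[p^{k+1}] → W[p^k]` given on points by `P ↦ p • P` is `Γ_ℚ`-equivariant for
the restricted representations of any subgroup `U ≤ Γ_ℚ` (the Galois action commutes with
multiplication by `p`: Perrin-Riou's transition maps "induits par la multiplication par `p`" are maps
of Galois modules). [cite: PerrinRiou1987BSMF, §0 (p. 401)] -/
theorem transition_subgroupRep
    (f : geomTorsion W ((p : ℤ) ^ (k + 1)) →+ geomTorsion W ((p : ℤ) ^ k))
    (hf : ∀ P, ((f P : geomTorsion W ((p : ℤ) ^ k)) : geomPoints W) = (p : ℤ) • (P : geomPoints W))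
    (U : Subgroup (absoluteGaloisGroup ℚ)) (u : U) (P : geomTorsion W ((p : ℤ) ^ (k + 1))) :
    f ((subgroupRep (W.torsionGaloisModule ((p : ℤ) ^ (k + 1))).toTopRep U).ρ u P) =
      (subgroupRep (W.torsionGaloisModule ((p : ℤ) ^ k)).toTopRep U).ρ u (f P) := by
  apply Subtype.ext
  change ((f ((u : absoluteGaloisGroup ℚ) • P) : geomTorsion W ((p : ℤ) ^ k)) : geomPoints W) =
    (((u : absoluteGaloisGroup ℚ) • f P : geomTorsion W ((p : ℤ) ^ k)) : geomPoints W)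
  rw [hf, AddSubgroup.torsionBy.coe_smul, AddSubgroup.torsionBy.coe_smul, hf]
  exact (map_zsmul (DistribSMul.toAddMonoidHom (geomPoints W) (u : absoluteGaloisGroup ℚ)) (p : ℤ)
    (P : geomPoints W)).symm

/-- **Tower compatibility of the reductions**: for any transition map `f : W[p^{k+1}] → W[p^k]`,
`P ↦ p • P` on points (e.g. `WeierstrassCurve.geomTorsionReduce W p k`), the induced map on `H¹(U, ·)`
takes `red_{p^{k+1}} c` to `red_{p^k} c` — on cocycles this is `p • a_{k+1} = a_k` componentwise
(`zsmul_coe_tateModPk_succ`).  So `(red_{p^k} c)_{k ≥ 1}` is a COMPATIBLE FAMILY in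
`lim←_k H¹(U, W[p^k])`, the shape in which a class of `H¹(U, T_pW)` is compared with Kummer classes of
points (`H¹(ℚ_p, T_pW) = lim←_k H¹(ℚ_p, W[p^k])`). [cite: PerrinRiou1987BSMF, §0 (p. 401)]
[cite: Kato2004Asterisque, §13.8 (p. 228)] -/
theorem mapH1AddHom_reduceH1Pk_succ (U : Subgroup (absoluteGaloisGroup ℚ))
    (f : geomTorsion W ((p : ℤ) ^ (k + 1)) →+ geomTorsion W ((p : ℤ) ^ k))
    (hf : ∀ P, ((f P : geomTorsion W ((p : ℤ) ^ k)) : geomPoints W) = (p : ℤ) • (P : geomPoints W))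
    (c : H1 (tateRep W p) U) :
    mapH1AddHom (subgroupRep (W.torsionGaloisModule ((p : ℤ) ^ (k + 1))).toTopRep U)
        (subgroupRep (W.torsionGaloisModule ((p : ℤ) ^ k)).toTopRep U) f
        continuous_of_discreteTopology (transition_subgroupRep W p k f hf U)
        (reduceH1Pk W p (k + 1) U c) =
      reduceH1Pk W p k U c := by
  obtain ⟨φ, rfl⟩ := oneCocycleClass_surjective _ c
  rw [reduceH1Pk_oneCocycleClass, reduceH1Pk_oneCocycleClass, mapH1AddHom_oneCocycleClass]
  refine congrArg _ (Subtype.ext (ContinuousMap.ext fun g ↦ Subtype.ext ?_))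
  change ((f (tateModPk W p (k + 1) (φ.1 g)) : geomTorsion W ((p : ℤ) ^ k)) : geomPoints W) =
    ((tateModPk W p k (φ.1 g) : geomTorsion W ((p : ℤ) ^ k)) : geomPoints W)
  rw [hf, zsmul_coe_tateModPk_succ]

end Reduction

/-! ## §4 The reductions on the pinned datum `𝐇¹_Γ(T_pW)` -/

namespace IwasawaH1Data

variable {W : WeierstrassCurve ℚ} [W.IsElliptic] {p : ℕ} [Fact p.Prime]
  [ContinuousSMul ℤ_[p] (W.tateModule p)] {κ : ZpExtension ℚ p} {γ : absoluteGaloisGroup ℚ}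
  (I : IwasawaH1Data W p κ γ) (k : ℕ)

/-- **The reduction `red_{p^k} : 𝐇¹_Γ(T_pW) → lim←_n H¹(ℚ_n, W[p^k])`** on the pinned datum, written
levelwise inside `∏_n H¹(ℚ_n, W[p^k])`: `x ↦ (red_{p^k} (proj n x))_n` (the twin of `IwasawaH1Data.red`,
which is `k = 1`).  Values are norm-compatible integral families (`redPk_mem_normCompatible`).
[cite: Kato2004Asterisque, §13.8 (pp. 228–229) with §12.2 (p. 220)] -/
def redPk : I.H →+ ∀ n : ℕ, H1 (W.torsionGaloisModule ((p : ℤ) ^ k)) (κ.layerSubgroup n) where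
  toFun x n := reduceH1Pk W p k (κ.layerSubgroup n) (I.proj n x)
  map_zero' := funext fun n ↦ by rw [map_zero, map_zero]; rfl
  map_add' x y := funext fun n ↦ by rw [map_add, map_add]; rfl

/-- Unfolding `redPk`: its `n`-th component is `red_{p^k} (proj n x)`. [cite: Kato2004Asterisque, §13.8 (p. 228)] -/
@[simp]
theorem redPk_apply (x : I.H) (n : ℕ) :
    I.redPk k x n = reduceH1Pk W p k (κ.layerSubgroup n) (I.proj n x) :=
  rfl

/-- The mod-`p^k` reduction of an element of `𝐇¹_Γ(T_pW)` is a norm-compatible integral family of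
`∏_n H¹(ℚ_n, W[p^k])` (`proj_mem`, `cores_proj` of the pin and `reduceH1Pk_mem_integralH1`,
`reduceH1Pk_layerCores`). [cite: Kato2004Asterisque, §12.2 (p. 220) and §13.8 (p. 228)] -/
theorem isNormCompatible_redPk (x : I.H) :
    IsNormCompatible (W.torsionGaloisModule ((p : ℤ) ^ k)) κ (I.redPk k x) := by
  refine ⟨fun n ↦ ?_, fun n ↦ ?_⟩
  · rw [redPk_apply]
    exact reduceH1Pk_mem_integralH1 W p k _ (I.proj_mem n x)
  · rw [redPk_apply, redPk_apply, ← reduceH1Pk_layerCores, I.cores_proj n x]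

/-- `redPk k x ∈ normCompatible (W.torsionGaloisModule (p^k)) κ = lim←_n H¹(ℤ_n[1/p], W[p^k])`.
[cite: Kato2004Asterisque, §12.2 (p. 220) and §13.8 (p. 228)] -/
theorem redPk_mem_normCompatible (x : I.H) :
    I.redPk k x ∈ normCompatible (W.torsionGaloisModule ((p : ℤ) ^ k)) κ :=
  I.isNormCompatible_redPk k x

/-- **`red_{p^k}` is semilinear for `T`**: `red_{p^k} (T • x) = (conj_γ − 1) (red_{p^k} x)` levelwise
(`proj_T_smul` of the pin and `reduceH1Pk_conjMap`). [cite: Kato2004Asterisque, §13.8 (p. 228)] -/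
theorem redPk_X_smul (x : I.H) (n : ℕ) :
    I.redPk k ((PowerSeries.X : IwasawaAlgebra p) • x) n =
      conjMap (W.torsionGaloisModule ((p : ℤ) ^ k)).toTopRep (κ.layerSubgroup n) γ 1 (I.redPk k x n) -
        I.redPk k x n := by
  rw [redPk_apply, I.proj_T_smul n x, map_sub, reduceH1Pk_conjMap, redPk_apply]

/-- Constants of `Λ` reduce through `ℤ_p → ℤ/p^k`: in particular `red_{p^k} (p^k • x) = 0`
(`proj_C_smul` and `reduceH1Pk_pow_smul`). [cite: Kato2004Asterisque, §13.8 (p. 228)] -/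
theorem redPk_C_pow_smul (x : I.H) :
    I.redPk k (PowerSeries.C ((p : ℤ_[p]) ^ k) • x) = 0 := by
  funext n
  rw [redPk_apply, I.proj_C_smul, reduceH1Pk_pow_smul]
  rfl

/-- **The level-`0` reduction out of the coinvariants, `red₀,{p^k} : 𝐇¹_Γ/T𝐇¹_Γ → H¹(Γ_ℚ, W[p^k])`,
`[x] ↦ red_{p^k}(proj₀ x)`** (`reduceH1Pk` at the bottom layer `κ.layerSubgroup 0 = Γ_ℚ` composed with
`IwasawaH1Data.projZero`, the first arrow of Kato's (14.14.1) followed by `T → T/p^k`).  For the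
Kato–zeta road this is the mod-`p^k` class of `ι(z̄) ∈ H¹(ℤ[1/p], T_pW)` before localisation at `p`
(definition item `defn-HasLocPKummerLog`, dialects α/β).  Plumbing definition.
[cite: Kato2004Asterisque, §14.14 (14.14.1) (p. 243) and §13.8 (p. 228)] -/
def redZeroPk : coinvariants p I.H →+ H1 (W.torsionGaloisModule ((p : ℤ) ^ k)) (κ.layerSubgroup 0) :=
  (reduceH1Pk W p k (κ.layerSubgroup 0)).comp I.projZero

/-- `red₀,{p^k}` on a class: `redZeroPk k [x] = red_{p^k} (proj 0 x) = (redPk k x) 0`.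
[cite: Kato2004Asterisque, §14.14 (14.14.1) (p. 243)] -/
@[simp]
theorem redZeroPk_mk (x : I.H) :
    I.redZeroPk k (Submodule.Quotient.mk x) = reduceH1Pk W p k (κ.layerSubgroup 0) (I.proj 0 x) :=
  rfl

/-- `red₀,{p^k} [x]` is the bottom component of the family `redPk k x`. [cite: Kato2004Asterisque, §13.8 (p. 228)] -/
theorem redZeroPk_mk_eq_redPk (x : I.H) :
    I.redZeroPk k (Submodule.Quotient.mk x) = I.redPk k x 0 :=
  rfl

/-- The values of `red₀,{p^k}` are integral classes `H¹(ℤ[1/p], W[p^k])` at level `0` (`projZero_mem`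
and `reduceH1Pk_mem_integralH1`). [cite: Kato2004Asterisque, §8.2 and §14.14 (pp. 180, 243)] -/
theorem redZeroPk_mem_integralH1 (x : coinvariants p I.H) :
    I.redZeroPk k x ∈ integralH1 (W.torsionGaloisModule ((p : ℤ) ^ k)) p (κ.layerSubgroup 0) := by
  induction x using Submodule.Quotient.induction_on with
  | H y => rw [redZeroPk_mk]; exact reduceH1Pk_mem_integralH1 W p k _ (I.proj_mem 0 y)

/-- **Tower compatibility at level `0`**: for any transition map `f : W[p^{k+1}] → W[p^k]`, `P ↦ p • P`,
`f_* (red₀,{p^{k+1}} x̄) = red₀,{p^k} x̄` — the family `(red₀,{p^k} x̄)_{k ≥ 1}` is compatible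
(`mapH1AddHom_reduceH1Pk_succ`). [cite: PerrinRiou1987BSMF, §0 (p. 401)] -/
theorem mapH1AddHom_redZeroPk_succ
    (f : geomTorsion W ((p : ℤ) ^ (k + 1)) →+ geomTorsion W ((p : ℤ) ^ k))
    (hf : ∀ P, ((f P : geomTorsion W ((p : ℤ) ^ k)) : geomPoints W) = (p : ℤ) • (P : geomPoints W))
    (x : coinvariants p I.H) :
    mapH1AddHom (subgroupRep (W.torsionGaloisModule ((p : ℤ) ^ (k + 1))).toTopRep (κ.layerSubgroup 0))
        (subgroupRep (W.torsionGaloisModule ((p : ℤ) ^ k)).toTopRep (κ.layerSubgroup 0)) f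
        continuous_of_discreteTopology (transition_subgroupRep W p k f hf (κ.layerSubgroup 0))
        (I.redZeroPk (k + 1) x) =
      I.redZeroPk k x := by
  induction x using Submodule.Quotient.induction_on with
  | H y => rw [redZeroPk_mk, redZeroPk_mk, mapH1AddHom_reduceH1Pk_succ W p k _ f hf]

end IwasawaH1Data

end Literature.NumberTheory.EllipticCurves.Kato2004

end
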